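import Literature.NumberTheory.LFunctions.Zhang2022.DetectorDictForm

/-!
# Zhang (2022), programme F-S3 (cell landau-siegel, family B-det): the six channel moments of a shift triple are
# SECOND DIVIDED DIFFERENCES — the recipe form at REPEATED shifts (double-pole residues) in closed form

Y. Zhang, *Discrete mean estimates and the Landau–Siegel zero*, arXiv:2211.02515v1 [Zhang2022LandauSiegel] —
an unrefereed manuscript under adjudication. **WHAT THIS IS NOT: not a claim about Theorems 1–2 of
arXiv:2211.02515, about Landau–Siegel zeros, or about Parity; nothing here asserts any claim of the manuscript.**
«The programme SEARCHES and TYPES; no claim about Landau–Siegel zeros, Theorems 1–2 of arXiv:2211.02515 or a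
repaired Margin232 until a kernel theorem says so.»

Part of definition request **D-det-1** (recipe forms), serving the cell's theory ruling (c1) of 2026-08-26T21:21:49Z:
«repeated shifts (`b_i = b_j`) = the `b`-derivative limit of the distinct-shift recipe (the double-pole residue) —
well-defined», needed by the class-DET members with polynomial weights `P₁(M(ρ+β_•))` containing repeated indices
(e.g. the SOS-cone recipes `X_a(X_b − X_c)²`, whose main term is `F(b_a,b_b,b_b) − 2F(b_a,b_b,b_c) + F(b_a,b_c,b_c)`).

OBSERVATION (typed and PROVED here for distinct triples): with `g_B(x) = e^{iπ(B−x)}`, `B = Σb/2`, `N = Πb`, the six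
channel moments of `Det.shiftRecipe b` (`Det.formDet_eq_moments`) are second DIVIDED DIFFERENCES at the nodes
`b₀, b₁, b₂` — the recipe's Vandermonde denominators `Π_{i≠j}(b_i − b_j)` ARE the divided-difference denominators:
`m₀ = (x·g_B)[b]`, `m_b = (x²g_B)[b]`, `m_s = 2B·m₀ − m_b`, `m_n = N·g_B[b]`, `m_bs = 2B·m_b − (x³g_B)[b]`, `m_bn = N·m₀`
(`moments_shiftRecipe_eq_dd`). Divided differences of smooth functions extend continuously to coincident nodes
(`h[p,p,q] = (h[p,q] − h′(p))/(q − p)`, `h[p,p,p] = h″(p)/2`), so the limit recipe needs no limit: `Det.dd2` is the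
confluent second divided difference (all coincidence cases, with the first two derivatives supplied as data),
`Det.ddM0 … ddMbn b` the six moments for EVERY real triple, `Det.SixMomentOf` the six-moment expression with the
moments as parameters (`sixMomentS_eq_sixMomentOf`), and **`Det.FormDetDD b g g′`** the recipe form of an arbitrary
triple — equal to `Det.FormDet (Det.shiftRecipe b) g g′` on one-sided kinked profiles when the entries are distinct
(**`formDetDD_eq_formDet`**), and DEFINED by the confluent formulas otherwise. STATUS of the confluent values as the
(A)-main term of a repeated-shift weight `…M(ρ+β)²…`: theory ruling (c1)(1) — derivation (desk), not a claim made here;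
as for every recipe object this is design data. Sesquilinear/polar twins: `Det.MformOf`, `Det.MformDD b g h`, `Det.FormDetPolarDD`
(`mformDD_eq_mformDet`, `formDetPolarDD_eq_formDetPolar` for distinct `b`) — the block entries `F(b_a,b_j,b_l)` of the cell's
cone scans with repeated indices. Sanity values: `ddM0 (1,2,3) = 4` (printed `ΣW`), `ddM0 (1,2,2) = 2π − 2i`.
-/

noncomputable section

open Complex Real

namespace Literature.NumberTheory.LFunctions.Zhang2022

namespace Det

open Repair

/-! ### The confluent second divided difference -/

open scoped Classical in
/-- **Second divided difference `h[x,y,z]` with confluent nodes** (`h′`, `h″` supplied as data, used only at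
coincidences): distinct nodes `Σ h(x_j)/Π_{i≠j}(x_i − x_j)`; `h[p,p,q] = (h[p,q] − h′(p))/(q − p)`; `h[p,p,p] = h″(p)/2`.
[folklore] -/
def dd2 (h h' h'' : ℝ → ℂ) (x y z : ℝ) : ℂ :=
  if x ≠ y ∧ y ≠ z ∧ x ≠ z then
    h x / (((y - x) * (z - x) : ℝ) : ℂ) + h y / (((x - y) * (z - y) : ℝ) : ℂ) + h z / (((x - z) * (y - z) : ℝ) : ℂ)
  else if x = y ∧ y = z then h'' x / 2
  else if x = y then ((h z - h x) / ((z - x : ℝ) : ℂ) - h' x) / ((z - x : ℝ) : ℂ)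
  else if y = z then ((h x - h y) / ((x - y : ℝ) : ℂ) - h' y) / ((x - y : ℝ) : ℂ)
  else ((h y - h x) / ((y - x : ℝ) : ℂ) - h' x) / ((y - x : ℝ) : ℂ)

/-- At pairwise distinct nodes `dd2` is the symmetric three-term sum (the shape of the recipe's residue sum
`Σ_j ℛ_j`, denominators `Π_{i≠j}(b_i − b_j)`). [cite: Zhang2022LandauSiegel, proof of Prop 7.1, (7.19)–(7.21)] -/
theorem dd2_of_ne (h h' h'' : ℝ → ℂ) {x y z : ℝ} (hxy : x ≠ y) (hyz : y ≠ z) (hxz : x ≠ z) :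
    dd2 h h' h'' x y z = h x / (((y - x) * (z - x) : ℝ) : ℂ) + h y / (((x - y) * (z - y) : ℝ) : ℂ)
      + h z / (((x - z) * (y - z) : ℝ) : ℂ) := by
  rw [dd2, if_pos ⟨hxy, hyz, hxz⟩]

/-! ### The node functions `x^k·e^{iπ(B−x)}` and their first two derivatives (as data) -/

/-- `h_k(x) = x^k e^{iπ(B−x)}`. [cite: Zhang2022LandauSiegel, proof of Prop 7.1, (7.19)–(7.21); Lemma 5.2 p.10] -/
def ddBase (B : ℝ) (k : ℕ) : ℝ → ℂ := fun x => (x : ℂ) ^ k * cexp (I * π * ((B - x : ℝ) : ℂ))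

/-- `h_k′(x) = (k x^{k−1} − iπ x^k) e^{iπ(B−x)}`. [folklore] -/
def ddBase' (B : ℝ) (k : ℕ) : ℝ → ℂ := fun x =>
  ((k : ℂ) * (x : ℂ) ^ (k - 1) - I * π * (x : ℂ) ^ k) * cexp (I * π * ((B - x : ℝ) : ℂ))

/-- `h_k″(x) = (k(k−1) x^{k−2} − 2iπk x^{k−1} − π² x^k) e^{iπ(B−x)}`. [folklore] -/
def ddBase'' (B : ℝ) (k : ℕ) : ℝ → ℂ := fun x =>
  ((k : ℂ) * ((k : ℂ) - 1) * (x : ℂ) ^ (k - 2) - 2 * I * π * (k : ℂ) * (x : ℂ) ^ (k - 1) - (π : ℂ) ^ 2 * (x : ℂ) ^ k)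
    * cexp (I * π * ((B - x : ℝ) : ℂ))

/-- The half-sum `B = (b₀ + b₁ + b₂)/2` of a shift triple. [cite: Zhang2022LandauSiegel, Lemma 5.2 p.10] -/
def shiftB (b : Fin 3 → ℝ) : ℝ := (b 0 + b 1 + b 2) / 2

/-- `(x^k g_B)[b₀,b₁,b₂]` with confluence. [cite: Zhang2022LandauSiegel, proof of Prop 7.1, (7.19)–(7.21)] -/
def ddOf (b : Fin 3 → ℝ) (k : ℕ) : ℂ :=
  dd2 (ddBase (shiftB b) k) (ddBase' (shiftB b) k) (ddBase'' (shiftB b) k) (b 0) (b 1) (b 2)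

/-! ### The six moments of an arbitrary real triple -/

/-- `m₀(b) = (x g_B)[b]` (`= ΣW_j` for distinct `b`). [cite: Zhang2022LandauSiegel, proof of Prop 7.1, (7.19)–(7.21)] -/
def ddM0 (b : Fin 3 → ℝ) : ℂ := ddOf b 1
/-- `m_b(b) = (x² g_B)[b]` (`= ΣW_jb_j`). [cite: Zhang2022LandauSiegel, §8 (8.13)–(8.18)] -/
def ddMb (b : Fin 3 → ℝ) : ℂ := ddOf b 2
/-- `m_s(b) = 2B·m₀ − m_b` (`= ΣW_js_j`, `s_j = 2B − b_j`). [cite: Zhang2022LandauSiegel, §8 (8.13)–(8.18)] -/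
def ddMs (b : Fin 3 → ℝ) : ℂ := 2 * (shiftB b : ℂ) * ddM0 b - ddMb b
/-- `m_n(b) = N·g_B[b]`, `N = b₀b₁b₂` (`= ΣW_jn_j`, `b_jn_j = N`). [cite: Zhang2022LandauSiegel, §8 (8.13)–(8.18)] -/
def ddMn (b : Fin 3 → ℝ) : ℂ := ((b 0 * b 1 * b 2 : ℝ) : ℂ) * ddOf b 0
/-- `m_bs(b) = 2B·m_b − (x³g_B)[b]` (`= ΣW_jb_js_j`). [cite: Zhang2022LandauSiegel, §8 (8.13)–(8.18)] -/
def ddMbs (b : Fin 3 → ℝ) : ℂ := 2 * (shiftB b : ℂ) * ddMb b - ddOf b 3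
/-- `m_bn(b) = N·m₀` (`= ΣW_jb_jn_j`). [cite: Zhang2022LandauSiegel, §8 (8.13)–(8.18)] -/
def ddMbn (b : Fin 3 → ℝ) : ℂ := ((b 0 * b 1 * b 2 : ℝ) : ℂ) * ddM0 b

/-! ### The six-moment expression with the moments as parameters -/

variable {R : DetRecipe} {g g' : ℝ → ℂ}

/-- `Det.SixMomentS` with the six moments as free parameters. [cite: Zhang2022LandauSiegel, Prop 7.1 with (8.11)–(8.23), pp.44–50] -/
def SixMomentOf (m0 ms mn mb mbs mbn : ℂ) (g g' : ℝ → ℂ) : ℝ :=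
  2 / π * m0.re * (∫ x in (0:ℝ)..1, ‖g' x‖ ^ 2)
    + 2 * (ms * ∫ x in (0:ℝ)..1, g' x * (starRingEnd ℂ) (g x)).im
    - 2 * (mb * ∫ x in (0:ℝ)..1, g x * (starRingEnd ℂ) (g' x)).im
    + 2 * π * (mn + mbs).re * (∫ x in (0:ℝ)..1, ‖g x‖ ^ 2)
    - 2 * π * (mn * (g 0 * (starRingEnd ℂ) (∫ x in (0:ℝ)..1, g x))).re
    - 2 * π ^ 2 * (mbn * ((∫ x in (0:ℝ)..1, g x) * (starRingEnd ℂ) (∫ x in (0:ℝ)..1, g x)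
        - ∫ x in (0:ℝ)..1, g x * (starRingEnd ℂ) (∫ t in (0:ℝ)..x, g t))).im

/-- `SixMomentS R = SixMomentOf (ΣW) (ΣWs) (ΣWn) (ΣWb) (ΣWbs) (ΣWbn)`. [cite: Zhang2022LandauSiegel, Prop 7.1 with (8.11)–(8.23), pp.44–50] -/
theorem sixMomentS_eq_sixMomentOf (R : DetRecipe) (g g' : ℝ → ℂ) :
    SixMomentS R g g' = SixMomentOf (∑ j : Fin 3, R.W j) (∑ j : Fin 3, R.W j * (R.s j : ℂ))
      (∑ j : Fin 3, R.W j * (R.n j : ℂ)) (∑ j : Fin 3, R.W j * (R.b j : ℂ))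
      (∑ j : Fin 3, R.W j * ((R.b j : ℂ) * (R.s j : ℂ))) (∑ j : Fin 3, R.W j * ((R.b j : ℂ) * (R.n j : ℂ))) g g' :=
  rfl

/-- **The recipe form of an ARBITRARY real shift triple** (repeats allowed): the six-moment expression with the
divided-difference moments. For distinct entries it is `𝔅_{R(b)}` (`formDetDD_eq_formDet`); at coincidences it is the
confluent value (the cell's «double-pole residue = ∂_b limit», theory (c1)(1)). Design data.
[cite: Zhang2022LandauSiegel, proof of Prop 7.1, (7.19)–(7.21); §8 (8.13)–(8.18)] -/
def FormDetDD (b : Fin 3 → ℝ) (g g' : ℝ → ℂ) : ℝ :=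
  SixMomentOf (ddM0 b) (ddMs b) (ddMn b) (ddMb b) (ddMbs b) (ddMbn b) g g'

/-! ### Distinct triples: the recipe's moments ARE the divided differences -/

/-- `(s_j − b_j)/2 = B − b_j`. [cite: Zhang2022LandauSiegel, §8 (8.13)–(8.18); Lemma 5.2 p.10] -/
theorem shiftS_sub_div_two (b : Fin 3 → ℝ) (j : Fin 3) : (shiftS b j - b j) / 2 = shiftB b - b j := by
  fin_cases j <;> simp [shiftS, shiftB] <;> ring

/-- The formula-I weight as a divided-difference term: `W_j = h₁(b_j)/Π_{i≠j}(b_i − b_j)`, `h₁ = x·g_B`.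
[cite: Zhang2022LandauSiegel, proof of Prop 7.1, (7.19)–(7.21)] -/
theorem shiftW_eq_ddBase (b : Fin 3 → ℝ) (j : Fin 3) :
    shiftW b j = ddBase (shiftB b) 1 (b j) / (shiftVdm b j : ℂ) := by
  rw [shiftW, shiftS_sub_div_two, ddBase, pow_one]

variable {b : Fin 3 → ℝ}

/-- Distinct entries, channels `0,1`. [folklore] -/
private theorem ne01 (h : Function.Injective b) : b 0 ≠ b 1 := fun e => absurd (h e) (by decide)
/-- Distinct entries, channels `1,2`. [folklore] -/
private theorem ne12 (h : Function.Injective b) : b 1 ≠ b 2 := fun e => absurd (h e) (by decide)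
/-- Distinct entries, channels `0,2`. [folklore] -/
private theorem ne02 (h : Function.Injective b) : b 0 ≠ b 2 := fun e => absurd (h e) (by decide)

/-- `ΣW_j = (x·g_B)[b]` for a distinct triple. [cite: Zhang2022LandauSiegel, proof of Prop 7.1, (7.19)–(7.21)] -/
theorem sum_shiftW_eq_ddM0 (h : Function.Injective b) : (∑ j : Fin 3, (shiftRecipe b).W j) = ddM0 b := by
  rw [ddM0, ddOf, dd2_of_ne _ _ _ (ne01 h) (ne12 h) (ne02 h)]
  simp only [shiftRecipe, Fin.sum_univ_three, shiftW_eq_ddBase, shiftVdm, ddBase, Matrix.cons_val_zero,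
    Matrix.cons_val_one, Matrix.cons_val_two, Matrix.head_cons, Matrix.tail_cons]
  push_cast
  ring

/-- `ΣW_jb_j = (x²·g_B)[b]`. [cite: Zhang2022LandauSiegel, §8 (8.13)–(8.18)] -/
theorem sum_shiftW_b_eq_ddMb (h : Function.Injective b) :
    (∑ j : Fin 3, (shiftRecipe b).W j * ((shiftRecipe b).b j : ℂ)) = ddMb b := by
  rw [ddMb, ddOf, dd2_of_ne _ _ _ (ne01 h) (ne12 h) (ne02 h)]
  simp only [shiftRecipe, Fin.sum_univ_three, shiftW_eq_ddBase, shiftVdm, ddBase, Matrix.cons_val_zero,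
    Matrix.cons_val_one, Matrix.cons_val_two, Matrix.head_cons, Matrix.tail_cons]
  push_cast
  ring

/-- `ΣW_js_j = 2B·m₀ − m_b`. [cite: Zhang2022LandauSiegel, §8 (8.13)–(8.18)] -/
theorem sum_shiftW_s_eq_ddMs (h : Function.Injective b) :
    (∑ j : Fin 3, (shiftRecipe b).W j * ((shiftRecipe b).s j : ℂ)) = ddMs b := by
  rw [ddMs, ddM0, ddMb, ddOf, ddOf, dd2_of_ne _ _ _ (ne01 h) (ne12 h) (ne02 h),
    dd2_of_ne _ _ _ (ne01 h) (ne12 h) (ne02 h)]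
  simp only [shiftRecipe, Fin.sum_univ_three, shiftW_eq_ddBase, shiftVdm, shiftS, shiftB, ddBase,
    Matrix.cons_val_zero, Matrix.cons_val_one, Matrix.cons_val_two, Matrix.head_cons, Matrix.tail_cons]
  push_cast
  ring

/-- `ΣW_jn_j = N·g_B[b]` (`b_jn_j = N`). [cite: Zhang2022LandauSiegel, §8 (8.13)–(8.18)] -/
theorem sum_shiftW_n_eq_ddMn (h : Function.Injective b) :
    (∑ j : Fin 3, (shiftRecipe b).W j * ((shiftRecipe b).n j : ℂ)) = ddMn b := by
  rw [ddMn, ddOf, dd2_of_ne _ _ _ (ne01 h) (ne12 h) (ne02 h)]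
  simp only [shiftRecipe, Fin.sum_univ_three, shiftW_eq_ddBase, shiftVdm, shiftN, ddBase,
    Matrix.cons_val_zero, Matrix.cons_val_one, Matrix.cons_val_two, Matrix.head_cons, Matrix.tail_cons]
  push_cast
  ring

/-- `ΣW_jb_js_j = 2B·m_b − (x³g_B)[b]`. [cite: Zhang2022LandauSiegel, §8 (8.13)–(8.18)] -/
theorem sum_shiftW_bs_eq_ddMbs (h : Function.Injective b) :
    (∑ j : Fin 3, (shiftRecipe b).W j * (((shiftRecipe b).b j : ℂ) * ((shiftRecipe b).s j : ℂ))) = ddMbs b := by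
  rw [ddMbs, ddMb, ddOf, ddOf, dd2_of_ne _ _ _ (ne01 h) (ne12 h) (ne02 h),
    dd2_of_ne _ _ _ (ne01 h) (ne12 h) (ne02 h)]
  simp only [shiftRecipe, Fin.sum_univ_three, shiftW_eq_ddBase, shiftVdm, shiftS, shiftB, ddBase,
    Matrix.cons_val_zero, Matrix.cons_val_one, Matrix.cons_val_two, Matrix.head_cons, Matrix.tail_cons]
  push_cast
  ring

/-- `ΣW_jb_jn_j = N·m₀`. [cite: Zhang2022LandauSiegel, §8 (8.13)–(8.18)] -/
theorem sum_shiftW_bn_eq_ddMbn (h : Function.Injective b) :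
    (∑ j : Fin 3, (shiftRecipe b).W j * (((shiftRecipe b).b j : ℂ) * ((shiftRecipe b).n j : ℂ))) = ddMbn b := by
  rw [ddMbn, ddM0, ddOf, dd2_of_ne _ _ _ (ne01 h) (ne12 h) (ne02 h)]
  simp only [shiftRecipe, Fin.sum_univ_three, shiftW_eq_ddBase, shiftVdm, shiftN, ddBase,
    Matrix.cons_val_zero, Matrix.cons_val_one, Matrix.cons_val_two, Matrix.head_cons, Matrix.tail_cons]
  push_cast
  ring

/-- **For a DISTINCT triple the divided-difference form IS the recipe form** on one-sided kinked profiles: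
`FormDetDD b g g′ = 𝔅_{R(b)}(g)`. [cite: Zhang2022LandauSiegel, proof of Prop 7.1, (7.19)–(7.21); §8 (8.13)–(8.18)] -/
theorem formDetDD_eq_formDet (h : Function.Injective b) (hg : KinkedProfile g g') (hg1 : g 1 = 0) :
    FormDetDD b g g' = FormDet (shiftRecipe b) g g' := by
  rw [formDet_eq_sixMomentS hg hg1, sixMomentS_eq_sixMomentOf, FormDetDD, ← sum_shiftW_eq_ddM0 h,
    ← sum_shiftW_s_eq_ddMs h, ← sum_shiftW_n_eq_ddMn h, ← sum_shiftW_b_eq_ddMb h, ← sum_shiftW_bs_eq_ddMbs h,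
    ← sum_shiftW_bn_eq_ddMbn h]

/-- Sanity: `m₀(1,2,3) = 4 = ΣW` of the printed recipe. [cite: Zhang2022LandauSiegel, Prop 7.1 p.44] -/
theorem ddM0_std : ddM0 ![1, 2, 3] = 4 := by
  have hinj : Function.Injective (![1, 2, 3] : Fin 3 → ℝ) := by
    intro i j hij
    fin_cases i <;> fin_cases j <;> first | rfl | simp at hij
  rw [← sum_shiftW_eq_ddM0 hinj, shiftRecipe_std]
  exact moments_zhang.1

/-! ### The sesquilinear (formula-I) and polar versions with the moments as parameters -/

/-- `M_R(g,h)` of `Det.MformDet_eq_moments` with the six moments as free parameters (formula I, sesquilinear).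
[cite: Zhang2022LandauSiegel, Prop 7.1 with (8.11)–(8.23), pp.44–50] -/
def MformOf (m0 ms mn mb mbs mbn : ℂ) (g g' h h' : ℝ → ℂ) : ℂ :=
  (((1 / π : ℝ)) : ℂ) *
    (m0 * (∫ x in (0:ℝ)..1, g' x * (starRingEnd ℂ) (h' x))
      - I * π * ms * (∫ x in (0:ℝ)..1, g' x * (starRingEnd ℂ) (h x))
      + I * π * mb * (∫ x in (0:ℝ)..1, g x * (starRingEnd ℂ) (h' x))
      + (π : ℂ) ^ 2 * (mn + mbs) * (∫ x in (0:ℝ)..1, g x * (starRingEnd ℂ) (h x))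
      - (π : ℂ) ^ 2 * mn * (g 0 * (starRingEnd ℂ) (∫ x in (0:ℝ)..1, h x))
      + I * (π : ℂ) ^ 3 * mbn * ((∫ x in (0:ℝ)..1, g x) * (starRingEnd ℂ) (∫ x in (0:ℝ)..1, h x)
          - ∫ x in (0:ℝ)..1, g x * (starRingEnd ℂ) (∫ t in (0:ℝ)..x, h t)))

/-- On one-sided kinked `g` (`g(1) = 0`) and kinked `h`: `M_R(g,h) = MformOf (moments of R) g h`.
[cite: Zhang2022LandauSiegel, Prop 7.1 with (8.11)–(8.23), pp.44–50] -/
theorem mformDet_eq_mformOf {h h' : ℝ → ℂ} (hg : KinkedProfile g g') (hh : KinkedProfile h h') (hg1 : g 1 = 0) :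
    MformDet R g g' h h' = MformOf (∑ j : Fin 3, R.W j) (∑ j : Fin 3, R.W j * (R.s j : ℂ))
      (∑ j : Fin 3, R.W j * (R.n j : ℂ)) (∑ j : Fin 3, R.W j * (R.b j : ℂ))
      (∑ j : Fin 3, R.W j * ((R.b j : ℂ) * (R.s j : ℂ))) (∑ j : Fin 3, R.W j * ((R.b j : ℂ) * (R.n j : ℂ)))
      g g' h h' := by
  rw [MformDet_eq_moments hg hh hg1, MformOf]

/-- **Formula I of an ARBITRARY real shift triple** (repeats allowed): `MformDD b g h := MformOf (dd-moments of b) g h`;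
for distinct entries `= M_{R(b)}(g,h)` (`mformDD_eq_mformDet`). The block entries `F(b_a,b_j,b_l)` of the cell's
det-D2⁺ / two-profile cone scans with repeated indices are these. Design data. [cite: Zhang2022LandauSiegel, Prop 7.1 with (8.11)–(8.23), pp.44–50] -/
def MformDD (b : Fin 3 → ℝ) (g g' h h' : ℝ → ℂ) : ℂ :=
  MformOf (ddM0 b) (ddMs b) (ddMn b) (ddMb b) (ddMbs b) (ddMbn b) g g' h h'

/-- The polar form of an arbitrary triple: `P^{dd}_b(g,h) = MformDD b g h + conj MformDD b h g`.
[cite: Zhang2022LandauSiegel, Prop 7.1 p.44, (8.11)–(8.12)] -/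
def FormDetPolarDD (b : Fin 3 → ℝ) (g g' h h' : ℝ → ℂ) : ℂ :=
  MformDD b g g' h h' + (starRingEnd ℂ) (MformDD b h h' g g')

/-- For a DISTINCT triple `MformDD b = M_{R(b)}` on one-sided kinked profiles.
[cite: Zhang2022LandauSiegel, Prop 7.1 with (8.11)–(8.23), pp.44–50] -/
theorem mformDD_eq_mformDet {h h' : ℝ → ℂ} (hb : Function.Injective b) (hg : KinkedProfile g g')
    (hh : KinkedProfile h h') (hg1 : g 1 = 0) :
    MformDD b g g' h h' = MformDet (shiftRecipe b) g g' h h' := by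
  rw [mformDet_eq_mformOf hg hh hg1, MformDD, ← sum_shiftW_eq_ddM0 hb, ← sum_shiftW_s_eq_ddMs hb,
    ← sum_shiftW_n_eq_ddMn hb, ← sum_shiftW_b_eq_ddMb hb, ← sum_shiftW_bs_eq_ddMbs hb, ← sum_shiftW_bn_eq_ddMbn hb]

/-- … and the polar forms agree: `FormDetPolarDD b g h = FormDetPolar (shiftRecipe b) g h` (both profiles one-sided kinked).
[cite: Zhang2022LandauSiegel, Prop 7.1 p.44, (8.11)–(8.12)] -/
theorem formDetPolarDD_eq_formDetPolar {h h' : ℝ → ℂ} (hb : Function.Injective b) (hg : KinkedProfile g g')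
    (hh : KinkedProfile h h') (hg1 : g 1 = 0) (hh1 : h 1 = 0) :
    FormDetPolarDD b g g' h h' = FormDetPolar (shiftRecipe b) g g' h h' := by
  rw [FormDetPolarDD, FormDetPolar, mformDD_eq_mformDet hb hg hh hg1, mformDD_eq_mformDet hb hh hg hh1]

/-! ### A confluent value (sanity check of the repeated-shift branch) -/

/-- `e^{iπ/2} = i`. [folklore] -/
private theorem cexp_pi_half : cexp (I * π * (((1 : ℝ) / 2 : ℝ) : ℂ)) = I := by
  rw [show I * π * (((1 : ℝ) / 2 : ℝ) : ℂ) = (((π / 2) : ℝ) : ℂ) * I by push_cast; ring, Complex.exp_mul_I,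
    ← Complex.ofReal_cos, ← Complex.ofReal_sin, Real.cos_pi_div_two, Real.sin_pi_div_two]
  push_cast
  ring

/-- `e^{3iπ/2} = −i`. [folklore] -/
private theorem cexp_three_pi_half : cexp (I * π * (((3 : ℝ) / 2 : ℝ) : ℂ)) = -I := by
  rw [show I * π * (((3 : ℝ) / 2 : ℝ) : ℂ) = π * I + (((π / 2) : ℝ) : ℂ) * I by push_cast; ring, Complex.exp_add,
    Complex.exp_pi_mul_I, Complex.exp_mul_I, ← Complex.ofReal_cos, ← Complex.ofReal_sin, Real.cos_pi_div_two,
    Real.sin_pi_div_two]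
  push_cast
  ring

/-- `h₁(1) = −i` for `B = 5/2`. [folklore] -/
private theorem ddBase_fiveHalves_one : ddBase (5 / 2) 1 1 = -I := by
  rw [ddBase]
  rw [show ((5 / 2 : ℝ) - 1) = (3 : ℝ) / 2 by norm_num, cexp_three_pi_half]
  push_cast
  ring

/-- `h₁(2) = 2i` for `B = 5/2`. [folklore] -/
private theorem ddBase_fiveHalves_two : ddBase (5 / 2) 1 2 = 2 * I := by
  rw [ddBase]
  rw [show ((5 / 2 : ℝ) - 2) = (1 : ℝ) / 2 by norm_num, cexp_pi_half]
  push_cast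
  ring

/-- `h₁′(2) = i + 2π` for `B = 5/2`. [folklore] -/
private theorem ddBase'_fiveHalves_two : ddBase' (5 / 2) 1 2 = I + 2 * π := by
  rw [ddBase']
  rw [show ((5 / 2 : ℝ) - 2) = (1 : ℝ) / 2 by norm_num, cexp_pi_half]
  push_cast
  simp only [pow_zero, pow_one, mul_one]
  linear_combination (-2 * (π : ℂ)) * Complex.I_sq

/-- **Repeated shift, confluent value:** `m₀(1,2,2) = (x·g_{5/2})[1,2,2] = (h[1,2] − h′(2))/(1−2) = 2π − 2i`
(`h(1) = −i`, `h(2) = 2i`, `h′(2) = i + 2π`) — the weight sum of the double-pole recipe `(β₁; β₂, β₂)`.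
[cite: Zhang2022LandauSiegel, proof of Prop 7.1, (7.19)–(7.21)] -/
theorem ddM0_one_two_two : ddM0 ![1, 2, 2] = 2 * π - 2 * I := by
  rw [ddM0, ddOf, dd2]
  simp only [shiftB, Matrix.cons_val_zero, Matrix.cons_val_one, Matrix.cons_val_two, Matrix.head_cons,
    Matrix.tail_cons]
  norm_num only [ne_eq, not_false_eq_true, and_true, and_false, ite_false, ite_true, true_and, false_and]
  rw [ddBase_fiveHalves_one, ddBase_fiveHalves_two, ddBase'_fiveHalves_two]
  push_cast
  ring

end Det

end Literature.NumberTheory.LFunctions.Zhang2022
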